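import Summits.BirchSwinnertonDyer.Rank1Residual.GaloisImage.LocalUnitsModPTransfer
import HarnessLib

/-!
# `[𝒪_Eˣ/p] − [𝒪_Eˣ[p]] = [𝒪_E/p]` for the full unit group (prime-to-`p` transfer, Bezout)
# (cell `b2b-bsdres`, team n1011, row T-EPC = Tate's local Euler–Poincaré characteristic; seat p04 GEN 7; stage B4c)

HONEST FRAMING (cell `b2b-bsdres`, run/shared/lean/b2b/bsd-rank1-residual/, verbatim in every
file): the goal of the cell is to DELETE the COMBINATION-SHAPED residual classes of the
Birch–Swinnerton-Dyer formula for ALL analytic-rank `≤ 1` elliptic curves over `ℚ` — "full BSD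
formula for every rank `≤ 1` curve in class `C`" assembled STRICTLY from published theorems — so
that the rank-`≤ 1` remainder becomes exactly the CONSTRUCTION-SHAPED classes, which are TYPED
(missing-input `Prop`s), NOT attempted. This is not "finishing BSD". Team n1011 (N10 / N11, the
additive block X4 ∧ `p = 3`): research route; no claim beyond the stated classes; nothing is
booked; no mark / label is changed by this file. Theorems only (no definition, no named fact, no
`sorry`); TOOL theorems.  (Placement: Summits/GaloisImage pending the operator move of the T-EPC
cone to the Literature homes.)

## What

* `ModPRepCount.nonempty_equiv_modP_of_coprime`, `nonempty_equiv_torsion_of_coprime` — for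
  `G`-stable `W' ≤ W ≤ V` with `m' W ≤ W'`, `p ∤ m'`: the inclusion induces EQUIVALENCES of
  `G`-representations `W'/pW' ≃ W/pW` and `W'[p] ≃ W[p]` (Bezout);
* `OneUnits.natCard_modP_units` — **`#Hom_Δ(Z, 𝒪_Eˣ/p) = #Hom_Δ(Z, 𝒪_E/p) · #Hom_Δ(Z, 𝒪_Eˣ[p])`**
  (`Δ = Gal(E/K)`, `p ∤ #Δ`, `pZ = 0`): stage B4b for `U♭ = {u | u^{p^a} ∈ U_1}`
  (`#(𝒪_E/p)ˣ = p^a m'`, `p ∤ m'`) and the transfer `𝒪_Eˣ ⊇ U♭` (`(𝒪_Eˣ)^{m'} ≤ U♭`).  This is the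
  unit-group term of Milne, *ADT* I Lemma 2.11 / proof of Thm. 2.8 ("`[U^{(p)}] = [R^{(p)}] + [U_p]`").

References: J. S. Milne, *Arithmetic Duality Theorems* (2006), I §2 (Lemmas 2.11–2.12)
[MilneADT2006]; J.-P. Serre, *Local Fields*, IV §2 [SerreLocalFields1979].
-/

noncomputable section

open Function
open scoped ValuativeRel

namespace Summit.BirchSwinnertonDyer.Rank1Residual.GaloisImage

/-! ### Prime-to-`p` transfer (Bezout) -/

namespace ModPRepCount

open Representation

variable {G : Type*} [Group G] {V : Type*} [AddCommGroup V] (ρ : Representation ℤ G V) (p : ℕ)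

/-- **`W'/pW' ≃ W/pW`** (as `G`-representations, induced by the inclusion) when `m' W ≤ W' ≤ W`
with `p ∤ m'`. [folklore] -/
theorem nonempty_equiv_modP_of_coprime {m' : ℕ} (hm' : Nat.Coprime m' p)
    (W W' : Submodule ℤ V) (hW : ∀ g, W ≤ W.comap (ρ g)) (hW' : ∀ g, W' ≤ W'.comap (ρ g))
    (hle : W' ≤ W) (hm : ∀ w ∈ W, (m' : ℤ) • w ∈ W') :
    Nonempty (((ρ.subrepresentation W' hW').quotient _
        (range_lsmul_le_comap (ρ.subrepresentation W' hW') p)).Equiv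
      ((ρ.subrepresentation W hW).quotient _ (range_lsmul_le_comap (ρ.subrepresentation W hW) p))) := by
  classical
  obtain ⟨α, β, hαβ⟩ : IsCoprime (m' : ℤ) (p : ℤ) := Nat.isCoprime_iff_coprime.2 hm'
  let ι : W' →ₗ[ℤ] W := Submodule.inclusion hle
  have hιp : LinearMap.range (LinearMap.lsmul ℤ W' p) ≤
      (LinearMap.range (LinearMap.lsmul ℤ W p)).comap ι := by
    rintro _ ⟨u, rfl⟩
    exact ⟨ι u, by simp [LinearMap.lsmul_apply]⟩
  let κ := (LinearMap.range (LinearMap.lsmul ℤ W' p)).mapQ _ ι hιp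
  have hκ : ∀ u : W', κ (Submodule.Quotient.mk u) = Submodule.Quotient.mk (ι u) := fun u => rfl
  -- Bezout decomposition `w = α m' w + β p w`
  have hdec : ∀ w : V, w = α • ((m' : ℤ) • w) + (p : ℤ) • (β • w) := fun w => by
    rw [smul_smul, smul_smul, ← add_smul, mul_comm (p : ℤ) β, hαβ, one_smul]
  have hsurj : Surjective κ := by
    intro y
    obtain ⟨w, rfl⟩ := Submodule.mkQ_surjective _ y
    refine ⟨Submodule.Quotient.mk ⟨α • ((m' : ℤ) • (w : V)), W'.smul_mem _ (hm _ w.2)⟩, ?_⟩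
    rw [hκ, Submodule.mkQ_apply, eq_comm, Submodule.Quotient.eq]
    refine ⟨β • w, ?_⟩
    apply Subtype.ext
    rw [LinearMap.lsmul_apply, Submodule.coe_sub, Submodule.coe_smul_of_tower, Submodule.coe_smul_of_tower]
    change (p : ℤ) • (β • (w : V)) = (w : V) - α • ((m' : ℤ) • (w : V))
    exact (sub_eq_of_eq_add' (hdec w)).symm
  have hinj : Injective κ := by
    rw [← LinearMap.ker_eq_bot, LinearMap.ker_eq_bot']
    intro x hx
    obtain ⟨u, rfl⟩ := Submodule.mkQ_surjective _ x
    rw [Submodule.mkQ_apply, hκ, Submodule.Quotient.mk_eq_zero] at hx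
    obtain ⟨w, hw⟩ := hx
    rw [Submodule.mkQ_apply, Submodule.Quotient.mk_eq_zero]
    -- `ι u = p • w` with `w ∈ W`; then `w ∈ W'`
    have hpw' := congrArg (fun t : W => (t : V)) hw
    simp only [LinearMap.lsmul_apply, Submodule.coe_smul_of_tower] at hpw'
    have hpw : (p : ℤ) • (w : V) ∈ W' := by rw [hpw']; exact u.2
    have hwW' : (w : V) ∈ W' := by
      rw [hdec (w : V), smul_comm (p : ℤ) β]
      exact W'.add_mem (W'.smul_mem _ (hm _ w.2)) (W'.smul_mem _ hpw)
    refine ⟨⟨w, hwW'⟩, Subtype.ext ?_⟩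
    have := congrArg (fun t : W => (t : V)) hw
    simp only [LinearMap.lsmul_apply, Submodule.coe_smul_of_tower] at this
    rw [LinearMap.lsmul_apply, Submodule.coe_smul_of_tower]
    exact this
  refine ⟨Representation.Equiv.mk (LinearEquiv.ofBijective κ ⟨hinj, hsurj⟩) fun g => LinearMap.ext fun x => ?_⟩
  obtain ⟨u, rfl⟩ := Submodule.mkQ_surjective _ x
  rfl

/-- **`W'[p] ≃ W[p]`** (as `G`-representations, the inclusion) when `m' W ≤ W' ≤ W`, `p ∤ m'`.
[folklore] -/
theorem nonempty_equiv_torsion_of_coprime {m' : ℕ} (hm' : Nat.Coprime m' p)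
    (W W' : Submodule ℤ V) (hW : ∀ g, W ≤ W.comap (ρ g)) (hW' : ∀ g, W' ≤ W'.comap (ρ g))
    (hle : W' ≤ W) (hm : ∀ w ∈ W, (m' : ℤ) • w ∈ W') :
    Nonempty (((ρ.subrepresentation W' hW').subrepresentation _
        (ker_lsmul_le_comap (ρ.subrepresentation W' hW') p)).Equiv
      ((ρ.subrepresentation W hW).subrepresentation _ (ker_lsmul_le_comap (ρ.subrepresentation W hW) p))) := by
  classical
  obtain ⟨α, β, hαβ⟩ : IsCoprime (m' : ℤ) (p : ℤ) := Nat.isCoprime_iff_coprime.2 hm'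
  let ι : W' →ₗ[ℤ] W := Submodule.inclusion hle
  have hι : ∀ t : LinearMap.ker (LinearMap.lsmul ℤ W' p), ι t ∈ LinearMap.ker (LinearMap.lsmul ℤ W p) :=
    fun t => by
    have ht := t.2
    rw [LinearMap.mem_ker, LinearMap.lsmul_apply] at ht ⊢
    rw [← map_smul, ht, map_zero]
  let κ : LinearMap.ker (LinearMap.lsmul ℤ W' p) →ₗ[ℤ] LinearMap.ker (LinearMap.lsmul ℤ W p) :=
    (ι.comp (LinearMap.ker (LinearMap.lsmul ℤ W' p)).subtype).codRestrict _ hι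
  have hinj : Injective κ := fun a b h => by
    have h' := congrArg (fun t : LinearMap.ker (LinearMap.lsmul ℤ W p) => ((t : W) : V)) h
    exact Subtype.ext (Subtype.ext h')
  have hsurj : Surjective κ := by
    intro t
    have ht := t.2
    rw [LinearMap.mem_ker, LinearMap.lsmul_apply] at ht
    have ht' : (p : ℤ) • ((t : W) : V) = 0 := by
      have := congrArg (fun x : W => (x : V)) ht
      simpa only [Submodule.coe_smul_of_tower, Submodule.coe_zero] using this
    have htW' : ((t : W) : V) ∈ W' := by
      have hdec : ((t : W) : V) = α • ((m' : ℤ) • ((t : W) : V)) + β • ((p : ℤ) • ((t : W) : V)) := by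
        rw [smul_smul, smul_smul, ← add_smul, hαβ, one_smul]
      rw [hdec, ht', smul_zero, add_zero]
      exact W'.smul_mem _ (hm _ (t : W).2)
    refine ⟨⟨⟨_, htW'⟩, ?_⟩, Subtype.ext (Subtype.ext rfl)⟩
    rw [LinearMap.mem_ker, LinearMap.lsmul_apply]
    exact Subtype.ext ht'
  refine ⟨Representation.Equiv.mk (LinearEquiv.ofBijective κ ⟨hinj, hsurj⟩) fun g => LinearMap.ext fun x =>
    Subtype.ext (Subtype.ext rfl)⟩

end ModPRepCount

/-! ### The full unit group -/

namespace OneUnits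

open Representation

variable {K : Type*} [Field K] {E : Type*} [Field E] [Algebra K E] [ValuativeRel E]
  [TopologicalSpace E] [IsNonarchimedeanLocalField E]
variable (p : ℕ) [hp : Fact p.Prime] [FiniteDimensional K E]

/-- **`#Hom_Δ(Z, 𝒪_Eˣ/p) = #Hom_Δ(Z, 𝒪_E/p) · #Hom_Δ(Z, 𝒪_Eˣ[p])`** (`Δ = Gal(E/K)`, `p ∤ #Δ`, `Z` finite
with `pZ = 0`): the unit-group term of Milne's Lemma 2.11 / proof of Thm. 2.8 ("`[U^{(p)}] = [R^{(p)}]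
+ [U_p]`"), assembled from stage B4b (`U♭`) and the Bezout transfer `𝒪_Eˣ ⊇ U♭`.
[cite: MilneADT2006, I §2 proof of Thm 2.8 (Lemmas 2.11-2.12, pp. 33-34)] -/
theorem natCard_modP_units [CharZero E] (hpv : ValuativeRel.valuation E p < 1)
    (hG : ¬ p ∣ Nat.card (E ≃ₐ[K] E))
    {Z : Type*} [AddCommGroup Z] [Finite Z] (σZ : Representation ℤ (E ≃ₐ[K] E) Z)
    (hZ : ∀ z : Z, p • z = 0)
    (U₁ U₂ U₃ OU : Submodule ℤ (Additive Eˣ))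
    (hU₁ : ∀ u : Additive Eˣ, u ∈ U₁ ↔ ∃ b ∈ 𝒪[E], ((Additive.toMul u : Eˣ) : E) = 1 + (p : E) ^ 1 * b)
    (hU₂ : ∀ u : Additive Eˣ, u ∈ U₂ ↔ ∃ b ∈ 𝒪[E], ((Additive.toMul u : Eˣ) : E) = 1 + (p : E) ^ 2 * b)
    (hU₃ : ∀ u : Additive Eˣ, u ∈ U₃ ↔ ∃ b ∈ 𝒪[E], ((Additive.toMul u : Eˣ) : E) = 1 + (p : E) ^ 3 * b)
    (hOU : ∀ u : Additive Eˣ, u ∈ OU ↔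
      ((Additive.toMul u : Eˣ) : E) ∈ 𝒪[E] ∧ (((Additive.toMul u)⁻¹ : Eˣ) : E) ∈ 𝒪[E])
    (hU₁st : ∀ σ, U₁ ≤ U₁.comap (Representation.ofMulDistribMulAction (E ≃ₐ[K] E) Eˣ σ))
    (hU₂st : ∀ σ, U₂ ≤ U₂.comap (Representation.ofMulDistribMulAction (E ≃ₐ[K] E) Eˣ σ))
    (hOUst : ∀ σ, OU ≤ OU.comap (Representation.ofMulDistribMulAction (E ≃ₐ[K] E) Eˣ σ))
    (O : Submodule ℤ E) (hO : ∀ x, x ∈ O ↔ x ∈ 𝒪[E])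
    (hOst : ∀ σ, O ≤ O.comap (Representation.ofDistribMulAction ℤ (E ≃ₐ[K] E) E σ)) :
    Nat.card (IntertwiningMap σZ (((Representation.ofMulDistribMulAction (E ≃ₐ[K] E) Eˣ).subrepresentation
        OU hOUst).quotient _ (ModPRepCount.range_lsmul_le_comap
          ((Representation.ofMulDistribMulAction (E ≃ₐ[K] E) Eˣ).subrepresentation OU hOUst) p))) =
    Nat.card (IntertwiningMap σZ ((((Representation.ofDistribMulAction ℤ (E ≃ₐ[K] E) E).subrepresentation
        O hOst).quotient _ (ModPRepCount.range_lsmul_le_comap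
          ((Representation.ofDistribMulAction ℤ (E ≃ₐ[K] E) E).subrepresentation O hOst) p)))) *
    Nat.card (IntertwiningMap σZ (((Representation.ofMulDistribMulAction (E ≃ₐ[K] E) Eˣ).subrepresentation
        OU hOUst).subrepresentation _ (ModPRepCount.ker_lsmul_le_comap
          ((Representation.ofMulDistribMulAction (E ≃ₐ[K] E) Eˣ).subrepresentation OU hOUst) p))) := by
  classical
  -- `m = #(𝒪/p)ˣ = p^a m'`, `p ∤ m'`
  haveI : Finite (𝒪[E] ⧸ Ideal.span {(p : 𝒪[E])}) := (natCard_quotient_two_eq p hpv U₂ hU₂).2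
  haveI : Finite ((𝒪[E] ⧸ Ideal.span {(p : 𝒪[E])})ˣ) := Finite.of_injective _ Units.val_injective
  have hm0 : Nat.card ((𝒪[E] ⧸ Ideal.span {(p : 𝒪[E])})ˣ) ≠ 0 := Nat.card_pos.ne'
  obtain ⟨a, m', hm', hm⟩ := Nat.exists_eq_pow_mul_and_not_dvd hm0 p hp.out.ne_one
  have hcop : Nat.Coprime m' p := Nat.coprime_comm.1 ((Nat.Prime.coprime_iff_not_dvd hp.out).2 hm')
  -- `U♭`
  let Ub : Submodule ℤ (Additive Eˣ) := OU ⊓ U₁.comap (LinearMap.lsmul ℤ (Additive Eˣ) ((p : ℤ) ^ a))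
  have hUb : ∀ u : Additive Eˣ, u ∈ Ub ↔ u ∈ OU ∧ p ^ a • u ∈ U₁ := fun u => by
    change u ∈ OU ∧ (p : ℤ) ^ a • u ∈ U₁ ↔ _
    rw [← Nat.cast_pow, natCast_zsmul]
  have hUbst := flat_le_comap p OU U₁ Ub hUb hOUst hU₁st (K := K)
  have hleO : Ub ≤ OU := fun u hu => ((hUb u).1 hu).1
  have hmW : ∀ u ∈ OU, (m' : ℤ) • u ∈ Ub := fun u hu => by
    rw [natCast_zsmul]
    refine (hUb _).2 ⟨nsmul_mem hu _, ?_⟩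
    rw [← mul_smul, ← hm]
    exact nsmul_card_mem_one p OU U₁ hOU hU₁ hu
  -- stage B4b for `U♭`
  have hflat := natCard_modP_flat p hpv hG σZ hZ U₁ U₂ U₃ OU Ub hU₁ hU₂ hU₃ hOU hUb hU₁st hU₂st hUbst O hO hOst
  -- Bezout transfer `OU ⊇ U♭`
  obtain ⟨eQ⟩ := ModPRepCount.nonempty_equiv_modP_of_coprime
    (Representation.ofMulDistribMulAction (E ≃ₐ[K] E) Eˣ) p hcop OU Ub hOUst hUbst hleO hmW
  obtain ⟨eT⟩ := ModPRepCount.nonempty_equiv_torsion_of_coprime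
    (Representation.ofMulDistribMulAction (E ≃ₐ[K] E) Eˣ) p hcop OU Ub hOUst hUbst hleO hmW
  have t1 : Nat.card (IntertwiningMap σZ (((Representation.ofMulDistribMulAction (E ≃ₐ[K] E) Eˣ).subrepresentation
        Ub hUbst).quotient _ (ModPRepCount.range_lsmul_le_comap
          ((Representation.ofMulDistribMulAction (E ≃ₐ[K] E) Eˣ).subrepresentation Ub hUbst) p))) =
      Nat.card (IntertwiningMap σZ (((Representation.ofMulDistribMulAction (E ≃ₐ[K] E) Eˣ).subrepresentation
        OU hOUst).quotient _ (ModPRepCount.range_lsmul_le_comap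
          ((Representation.ofMulDistribMulAction (E ≃ₐ[K] E) Eˣ).subrepresentation OU hOUst) p))) :=
    ModPRepCount.natCard_intertwiningMap_congr_right σZ _ _ eQ
  have t2 : Nat.card (IntertwiningMap σZ (((Representation.ofMulDistribMulAction (E ≃ₐ[K] E) Eˣ).subrepresentation
        Ub hUbst).subrepresentation _ (ModPRepCount.ker_lsmul_le_comap
          ((Representation.ofMulDistribMulAction (E ≃ₐ[K] E) Eˣ).subrepresentation Ub hUbst) p))) =
      Nat.card (IntertwiningMap σZ (((Representation.ofMulDistribMulAction (E ≃ₐ[K] E) Eˣ).subrepresentation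
        OU hOUst).subrepresentation _ (ModPRepCount.ker_lsmul_le_comap
          ((Representation.ofMulDistribMulAction (E ≃ₐ[K] E) Eˣ).subrepresentation OU hOUst) p))) :=
    ModPRepCount.natCard_intertwiningMap_congr_right σZ _ _ eT
  rw [t1, t2] at hflat
  exact hflat

end OneUnits

end Summit.BirchSwinnertonDyer.Rank1Residual.GaloisImage

end
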